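import Literature.Algebra.EuclideanLattices.DualGridQueryGroup
import Literature.Algebra.EuclideanLattices.MRCombiningQuery
import Literature.Probability.Distributions.UniformFibreApprox
import HarnessLib

/-!
# The query of one attempt is nearly uniform: MR07 Lemma 5.8 (i) on the integer fine grid, with explicit statistical slack

Topic `Algebra/EuclideanLattices` (family `pqc`), sequel of `DualGridQueryGroup.lean` (the finite group
`𝔾 ≅ (1/N)ℤⁿ/L(S)` of one attempt, the map `ψ : 𝔾 → Grp` to the offsets with its section `sec`, the
`S`-coordinate embedding `Ξ̄`, the query `queryOf`, and `cast_aEntOf_eq_queryOf`: the machine's query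
column is `queryOf (sec c + [N G κ])`). Here the first property of Micciancio–Regev 2007, Lemma 5.8
("if `C` is uniform then the query `A` is uniform", authors' version p. 21) is proved for this
bit-level model, where two exactnesses of the idealised proof fail and are replaced by explicit
statistical bounds: the `v`-randomness is a coin box reduced modulo `ℤⁿ/T ℤⁿ` (not exactly uniform),
and `q` need not divide the grid parameter `N` (the rounding `⌊q S⁻¹w⌋` is only nearly uniform).
Everything PROVED:

* `uniform_bind_map_add` — adding anything independent to a uniform group element keeps it uniform;
* `val_add_D0_mul`, **`tvDist_roundCoord_uniform_le`** — on a coset of the coarse grid the `j`-th query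
  coordinate is `k ↦ ⌊q·val(θ + D₀k)/MM⌋`, `D₀ = MM/N = dT·Dg`, a bijective re-indexing of
  `k ↦ ⌊q(D₀k + r)/(D₀N)⌋`, hence within `q/N` of uniform (`tvDist_map_divRound_uniform_le`);
* **`tvDist_map_queryOf_uniform_le`** — for `g` uniform on `𝔾`, the query column `queryOf g` is within
  `n·q/N` of uniform on `(ℤ/q)ⁿ` (decompose `g = g₀ + ∑ kⱼ[sⱼ]` with `k` uniform on `[0,N)ⁿ`: the
  coordinates are then independent, `xiBar_add_sum`; mixture over `g₀`);
* **`tvDist_offsetLaw_uniform_le`** — for offsets `c ∼ μ` and `v`-randomness `κ ∼ ν`,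
  `Δ(law(sec c + [N G κ]), U(𝔾)) ≤ Δ(μ, U(Grp)) + Δ(law[N G κ], U(ker ψ))`
  (the pad lemma `MicciancioRegev2007.tvDist_bind_pad_uniform_le` after replacing the kernel part by a
  uniform one);
* `kerHom`, `kerHom_surjective`, **`tvDist_boxLaw_ker_uniform_le`** — for `κ` uniform on the box
  `[0, 2^ℓ)ⁿ`, `Δ(law[N G κ], U(ker ψ)) ≤ n·dT/2^ℓ` (`[N G κ]` factors through `κ mod dT` and a
  SURJECTIVE homomorphism `(ℤ/dT)ⁿ → ker ψ`; `tvDist_map_natMod_uniform_le`);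
* **`tvDist_queryColumn_uniform_le`** — the query column of one sample, computed by the machine
  (`aEntOf`), is within `Δ(μ, U(Grp)) + n·dT/2^ℓ + n·q/N` of uniform; and for `m` independent samples
  **`tvDist_queryMatrix_uniform_le`** — the query matrix `A ∈ ℤ_q^{n×m}` (the tree's `SIS` convention)
  is within `∑ᵢ (Δ(μᵢ, U) + n·dT/2^ℓ + n·q/N)` of uniform.

## References

* D. Micciancio, O. Regev, *Worst-case to average-case reductions based on Gaussian measures*,
  SIAM J. Comput. 37 (2007) 267–302; authors' version, Lemma 5.8 (first property, p. 21) and Thm. 5.9,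
  eq. (13) (p. 23).
* O. Goldreich, *Foundations of Cryptography I*, CUP 2001, §3.2 (statistical distance under processing)
  [Goldreich2001].
-/

noncomputable section

open scoped Classical

namespace Literature.Algebra.EuclideanLattices

open Module Submodule Matrix GSInverse Finset Literature.Probability.Distributions
  Literature.InformationTheory.Coding PMF

namespace DualGrid

/-! ### A tool: uniform plus independent is uniform -/

/-- **Adding an independent quantity to a uniform element of a finite group keeps it uniform.**
[folklore] -/
theorem uniform_bind_map_add {G X : Type*} [AddGroup G] [Fintype G] [Nonempty G] (ν : PMF X) (f : X → G) :
    ((PMF.uniformOfFintype G).bind fun g => ν.map fun x => g + f x) = PMF.uniformOfFintype G := by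
  have h1 : (fun g : G => ν.map fun x => g + f x) = fun g => ν.bind fun x => PMF.pure (g + f x) := by
    funext g; rw [← PMF.bind_pure_comp]; rfl
  rw [h1, PMF.bind_comm]
  have h2 : (fun x : X => (PMF.uniformOfFintype G).bind fun g => PMF.pure (g + f x)) = fun _ => PMF.uniformOfFintype G := by
    funext x
    rw [show (fun g : G => PMF.pure (g + f x)) = PMF.pure ∘ (· + f x) from rfl, PMF.bind_pure_comp]
    exact map_uniformOfFintype_of_bijective _ (Equiv.addRight (f x)).bijective
  rw [h2, PMF.bind_const]

variable {n : ℕ} {B : Matrix (Fin n) (Fin n) ℤ} {N : ℕ} {S : Fin n → Fin n → ℤ}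

section Main

variable (hB : B.det ≠ 0) [NeZero N] (hS : ∀ j, intVecToEuclidean n (S j) ∈ dualLat B)
  (hli : LinearIndependent ℝ fun j => intVecToEuclidean n (S j)) [NeZero (MM B N S)] [NeZero (Mo B N)]

include hB hS hli

/-! ### The coarse step `D₀ = dT·Dg = MM/N` -/

omit [NeZero N] [NeZero (MM B N S)] [NeZero (Mo B N)] in
/-- `D₀ = dT·Dg` as a natural number. [folklore] -/
theorem D0_pos : 0 < (dT B S).toNat * (Dg B).toNat :=
  Nat.mul_pos (by have := dT_pos hB hS hli; omega) (by have := Dg_pos hB; omega)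

omit [NeZero (MM B N S)] [NeZero (Mo B N)] in
/-- `MM = D₀ · N`. [folklore] -/
theorem MM_eq_D0_mul : MM B N S = (dT B S).toNat * (Dg B).toNat * N := by
  rw [MM_eq_mul_Mo hB hS hli, Mo]; ring

omit [NeZero N] [NeZero (MM B N S)] [NeZero (Mo B N)] in
/-- `(dT·Dg : ℤ) = D₀` in `ℤ/MM`. [folklore] -/
theorem cast_dT_mul_Dg : ((dT B S * Dg B : ℤ) : ZMod (MM B N S)) = (((dT B S).toNat * (Dg B).toNat : ℕ) : ZMod (MM B N S)) := by
  have h : (dT B S * Dg B : ℤ) = (((dT B S).toNat * (Dg B).toNat : ℕ) : ℤ) := by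
    rw [Nat.cast_mul, Int.toNat_of_nonneg (dT_pos hB hS hli).le, Int.toNat_of_nonneg (Dg_pos hB).le]
  rw [h, Int.cast_natCast]

/-! ### One coordinate on a coset: a re-indexed coarse rounding -/

omit hB hS hli [NeZero N] [NeZero (MM B N S)] [NeZero (Mo B N)] in
/-- `(D₀ m + r) mod (D₀ N) = D₀ (m mod N) + r` for `r < D₀`. [folklore] -/
theorem mul_add_mod_mul {D0 N' m r : ℕ} (hr : r < D0) : (D0 * m + r) % (D0 * N') = D0 * (m % N') + r := by
  rcases Nat.eq_zero_or_pos N' with rfl | hN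
  · simp
  · have h1 : D0 * m + r = D0 * N' * (m / N') + (D0 * (m % N') + r) := by
      have := Nat.div_add_mod m N'
      calc D0 * m + r = D0 * (N' * (m / N') + m % N') + r := by rw [this]
        _ = _ := by ring
    rw [h1, Nat.mul_add_mod]
    apply Nat.mod_eq_of_lt
    have : m % N' ≤ N' - 1 := by have := Nat.mod_lt m hN; omega
    calc D0 * (m % N') + r < D0 * (m % N') + D0 := by omega
      _ = D0 * (m % N' + 1) := by ring
      _ ≤ D0 * N' := Nat.mul_le_mul_left _ (by omega)

omit [NeZero (Mo B N)] in
/-- **The value of `θ + D₀ k` in `[0, MM)`**: with `θ.val = D₀ t₀ + r` (`r < D₀`, `t₀ < N`),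
`val(θ + D₀ k) = D₀((t₀ + k) mod N) + r`. [folklore] -/
theorem val_add_D0_mul (θ : ZMod (MM B N S)) (k : ℕ) :
    (θ + (((dT B S).toNat * (Dg B).toNat : ℕ) : ZMod (MM B N S)) * (k : ZMod (MM B N S))).val =
      (dT B S).toNat * (Dg B).toNat * ((θ.val / ((dT B S).toNat * (Dg B).toNat) + k) % N) +
        θ.val % ((dT B S).toNat * (Dg B).toNat) := by
  set D0 : ℕ := (dT B S).toNat * (Dg B).toNat with hD0
  have hD0 : 0 < D0 := D0_pos hB hS hli
  have hMM : MM B N S = D0 * N := MM_eq_D0_mul hB hS hli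
  rw [ZMod.val_add, ← Nat.cast_mul, ZMod.val_natCast, Nat.add_mod_mod]
  have e : (θ.val + D0 * k) % MM B N S = (θ.val + D0 * k) % (D0 * N) := congrArg ((θ.val + D0 * k) % ·) hMM
  rw [e]
  have hθ : θ.val = D0 * (θ.val / D0) + θ.val % D0 := (Nat.div_add_mod _ _).symm
  conv_lhs => rw [hθ, show D0 * (θ.val / D0) + θ.val % D0 + D0 * k = D0 * (θ.val / D0 + k) + θ.val % D0 by ring]
  exact mul_add_mod_mul (Nat.mod_lt _ hD0)

omit [NeZero (Mo B N)] in
/-- **One query coordinate on a coset is within `q/N` of uniform**: for `k` uniform on `[0, N)` and any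
`θ ∈ ℤ/MM`, the class of `⌊q · val(θ + D₀k)/MM⌋` in `ℤ/q` is within `q/N` of uniform (`1 ≤ q ≤ N`).
[cite: MicciancioRegev2007, Lemma 5.8 (i)] -/
theorem tvDist_roundCoord_uniform_le {q : ℕ} [NeZero q] (hqN : q ≤ N) (θ : ZMod (MM B N S)) :
    ((PMF.uniformOfFintype (Fin N)).map fun k : Fin N =>
        ((q * (θ + (((dT B S).toNat * (Dg B).toNat : ℕ) : ZMod (MM B N S)) * ((k : ℕ) : ZMod (MM B N S))).val /
          MM B N S : ℕ) : ZMod q)).tvDist (PMF.uniformOfFintype (ZMod q)) ≤ (q : ℝ) / N := by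
  set D0 : ℕ := (dT B S).toNat * (Dg B).toNat with hD0
  have hD0 : 0 < D0 := D0_pos hB hS hli
  have hMM : MM B N S = D0 * N := MM_eq_D0_mul hB hS hli
  have hNpos : 0 < N := Nat.pos_of_ne_zero (NeZero.ne N)
  set t₀ : ℕ := θ.val / D0 with ht₀
  set r : ℕ := θ.val % D0 with hr
  have hrD : r < D0 := Nat.mod_lt _ hD0
  have ht₀N : t₀ < N := by
    rw [ht₀, Nat.div_lt_iff_lt_mul hD0, mul_comm]; exact lt_of_lt_of_eq (ZMod.val_lt θ) hMM
  -- re-index by the rotation `k ↦ t₀ + k` of `Fin N`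
  set σ : Fin N → Fin N := fun k => (⟨t₀, ht₀N⟩ : Fin N) + k with hσ
  have hσbij : Function.Bijective σ := (Equiv.addLeft (⟨t₀, ht₀N⟩ : Fin N)).bijective
  set g : Fin N → ZMod q := fun k' => ((q * (D0 * (k' : ℕ) + r) / (D0 * N) : ℕ) : ZMod q) with hg
  have hfg : (fun k : Fin N => ((q * (θ + ((D0 : ℕ) : ZMod (MM B N S)) * ((k : ℕ) : ZMod (MM B N S))).val /
      MM B N S : ℕ) : ZMod q)) = g ∘ σ := by
    funext k
    simp only [Function.comp_apply, hg, hσ]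
    rw [val_add_D0_mul hB hS hli θ k, ← ht₀, ← hr, hMM, Fin.val_add]
  rw [hfg, ← PMF.map_comp, map_uniformOfFintype_of_bijective σ hσbij]
  exact tvDist_map_divRound_uniform_le hqN hD0 hrD

/-! ### The query of a uniform element of `𝔾` -/

omit [NeZero (Mo B N)] in
/-- **On a coset the query law is a product**: for `g₀ ∈ 𝔾` and `k` uniform on `[0,N)ⁿ`, the query of
`g₀ + ∑ⱼ kⱼ[sⱼ]` is within `n·q/N` of uniform on `(ℤ/q)ⁿ`. [cite: MicciancioRegev2007, Lemma 5.8 (i)] -/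
theorem tvDist_queryLaw_coset_le {q : ℕ} [NeZero q] (hqN : q ≤ N) (g₀ : GG B N S) :
    ((PMF.uniformOfFintype (Fin n → Fin N)).map fun k =>
        queryOf B N S (HS_le_ker_xiMod hB hS hli) q (g₀ + ∑ j, ((k j : ℕ)) • mkG B N S (S j))).tvDist
        (PMF.uniformOfFintype (Fin n → ZMod q)) ≤ n * ((q : ℝ) / N) := by
  set θ := xiBar B N S (HS_le_ker_xiMod hB hS hli) g₀ with hθ
  set f : Fin n → Fin N → ZMod q := fun j k =>
    ((q * (θ j + (((dT B S).toNat * (Dg B).toNat : ℕ) : ZMod (MM B N S)) * ((k : ℕ) : ZMod (MM B N S))).val /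
      MM B N S : ℕ) : ZMod q) with hf
  have hmap : (fun k : Fin n → Fin N => queryOf B N S (HS_le_ker_xiMod hB hS hli) q (g₀ + ∑ j, ((k j : ℕ)) • mkG B N S (S j))) =
      fun k j => f j (k j) := by
    funext k j
    simp only [queryOf, hf]
    rw [xiBar_add_sum hB hS hli g₀ (fun j => (k j : ℕ)), ← hθ, Pi.add_apply, cast_dT_mul_Dg hB hS hli]
  rw [hmap, ← indepLaw_uniformOfFintype n, indepLaw_map_pi]
  refine (tvDist_indepLaw_uniformOfFintype_le n _).trans ?_
  calc ∑ j, ((PMF.uniformOfFintype (Fin N)).map (f j)).tvDist (PMF.uniformOfFintype (ZMod q))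
      ≤ ∑ _j : Fin n, (q : ℝ) / N := Finset.sum_le_sum fun j _ => tvDist_roundCoord_uniform_le hB hS hli hqN (θ j)
    _ = n * ((q : ℝ) / N) := by simp

omit [NeZero (Mo B N)] in
/-- **The query of a uniform element of `𝔾` is within `n·q/N` of uniform on `(ℤ/q)ⁿ`.**
[cite: MicciancioRegev2007, Lemma 5.8 (i) ("it easily follows that A is distributed uniformly")] -/
theorem tvDist_map_queryOf_uniform_le {q : ℕ} [NeZero q] (hqN : q ≤ N) :
    ((PMF.uniformOfFintype (GG B N S)).map (queryOf B N S (HS_le_ker_xiMod hB hS hli) q)).tvDist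
        (PMF.uniformOfFintype (Fin n → ZMod q)) ≤ n * ((q : ℝ) / N) := by
  have hU := uniform_bind_map_add (G := GG B N S) (PMF.uniformOfFintype (Fin n → Fin N))
    (fun k => ∑ j, ((k j : ℕ)) • mkG B N S (S j))
  conv_lhs => rw [← hU, PMF.map_bind]
  rw [tvDist_comm, ← PMF.bind_const (PMF.uniformOfFintype (GG B N S)) (PMF.uniformOfFintype (Fin n → ZMod q))]
  refine tvDist_bind_le_of_forall_le _ _ _ fun g₀ => ?_
  rw [tvDist_comm, PMF.map_comp]
  exact tvDist_queryLaw_coset_le hB hS hli hqN g₀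

/-! ### The law of `sec c + [N G κ]`: pad lemma plus kernel slack -/

/-- The map `ψ : 𝔾 →+ Grp` of this attempt (its two proof arguments supplied). [folklore] -/
abbrev psiM : GG B N S →+ Grp B N := psi B N S (Mo_dvd_MM hB hS hli) (HS_le_comap hB hS (Mo_dvd_MM hB hS hli))

/-- The kernel element `[N G κ] ∈ ker ψ`. [folklore] -/
def kerElt (κ : Fin n → ℤ) : (psiM (N := N) hB hS hli).ker :=
  ⟨mkG B N S (N • (G B *ᵥ κ)), by rw [AddMonoidHom.mem_ker]; exact psi_mkG_kerVec _ _ κ⟩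

omit [NeZero (MM B N S)] [NeZero (Mo B N)] in
/-- `↑(kerElt κ) = [N G κ]`. [folklore] -/
@[simp] theorem coe_kerElt (κ : Fin n → ℤ) : ((kerElt (N := N) hB hS hli κ : (psiM (N := N) hB hS hli).ker) : GG B N S) =
    mkG B N S (N • (G B *ᵥ κ)) := rfl

/-- **Offsets plus kernel randomness**: for `c ∼ μ` on `Grp` and an independent `κ ∼ ν`,
`Δ(law(sec c + [N G κ]), U(𝔾)) ≤ Δ(μ, U(Grp)) + Δ(law[N G κ], U(ker ψ))`.
[cite: MicciancioRegev2007, Lemma 5.8 (i) with Thm. 5.9 eq. (13)] -/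
theorem tvDist_offsetLaw_uniform_le (μ : PMF (Grp B N)) (ν : PMF (Fin n → ℤ)) :
    (μ.bind fun c => ν.map fun κ => sec B N S c + mkG B N S (N • (G B *ᵥ κ))).tvDist (PMF.uniformOfFintype (GG B N S)) ≤
      μ.tvDist (PMF.uniformOfFintype (Grp B N)) +
        (ν.map (kerElt (N := N) hB hS hli)).tvDist (PMF.uniformOfFintype (psiM (N := N) hB hS hli).ker) := by
  -- the translation maps `h ↦ sec c + h` on the kernel
  set F : Grp B N → (psiM (N := N) hB hS hli).ker → GG B N S := fun c h => sec B N S c + (h : GG B N S) with hF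
  have h1 : ∀ c, (ν.map fun κ => sec B N S c + mkG B N S (N • (G B *ᵥ κ))) = (ν.map (kerElt (N := N) hB hS hli)).map (F c) := by
    intro c
    rw [PMF.map_comp]
    congr 1
  have h2 : (μ.bind fun c => ν.map fun κ => sec B N S c + mkG B N S (N • (G B *ᵥ κ))) =
      μ.bind fun c => (ν.map (kerElt (N := N) hB hS hli)).map (F c) := by
    congr 1; funext c; exact h1 c
  rw [h2]
  have h3 : (μ.bind fun c => (ν.map (kerElt (N := N) hB hS hli)).map (F c)).tvDist
      (μ.bind fun c => (PMF.uniformOfFintype (psiM (N := N) hB hS hli).ker).map (F c)) ≤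
      (ν.map (kerElt (N := N) hB hS hli)).tvDist (PMF.uniformOfFintype (psiM (N := N) hB hS hli).ker) :=
    tvDist_bind_le_of_forall_le μ _ _ fun c => tvDist_map_le_holds (F c) _ _
  have h4 : (μ.bind fun c => (PMF.uniformOfFintype (psiM (N := N) hB hS hli).ker).map (F c)).tvDist
      (PMF.uniformOfFintype (GG B N S)) ≤ μ.tvDist (PMF.uniformOfFintype (Grp B N)) :=
    MicciancioRegev2007.tvDist_bind_pad_uniform_le (psiM (N := N) hB hS hli) (sec B N S) (psi_sec hB _ _) μ
  linarith [tvDist_triangle_holds (μ.bind fun c => (ν.map (kerElt (N := N) hB hS hli)).map (F c))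
    (μ.bind fun c => (PMF.uniformOfFintype (psiM (N := N) hB hS hli).ker).map (F c)) (PMF.uniformOfFintype (GG B N S))]

/-! ### The kernel part from a coin box -/

/-- The law of an integer vector with independent coordinates uniform on `[0, 2^ℓ)` (a coin box). [folklore] -/
def boxLaw (n ℓ : ℕ) : PMF (Fin n → ℤ) := (PMF.uniformOfFintype (Fin n → Fin (2 ^ ℓ))).map fun x i => ((x i : ℕ) : ℤ)

/-- `κ ↦ [N G κ]` as a homomorphism into `ker ψ`. [folklore] -/
def kerHom₀ : (Fin n → ℤ) →+ (psiM (N := N) hB hS hli).ker where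
  toFun := kerElt hB hS hli
  map_zero' := by apply Subtype.ext; simp [kerElt, mkG]
  map_add' κ κ' := by apply Subtype.ext; simp [kerElt, Matrix.mulVec_add, smul_add, mkG_add]

omit [NeZero N] [NeZero (MM B N S)] [NeZero (Mo B N)] in
/-- `[N G (dT e)] = 0` in `𝔾`: `N G (dT e) = N ∑ⱼ (GT e)ⱼ sⱼ ∈ N·L(S)`. [folklore] -/
theorem mkG_kerVec_dT_smul (e : Fin n → ℤ) : mkG B N S (N • (G B *ᵥ (dT B S • e))) = 0 := by
  have h : G B *ᵥ (dT B S • e) = ∑ j, (GT B S *ᵥ e) j • S j := by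
    rw [sum_smul_S_eq hB hS, Matrix.mulVec_mulVec e (TS B S) (GT B S), TS_mul_GT hB hS hli, Matrix.smul_mulVec,
      Matrix.one_mulVec]
  rw [h, show (0 : GG B N S) = mkG B N S 0 by simp [mkG], eq_comm, mkG_eq_mkG_iff]
  exact ⟨GT B S *ᵥ e, 0, by simp⟩

omit [NeZero (MM B N S)] [NeZero (Mo B N)] in
/-- `kerHom₀` only depends on `κ mod dT`. [folklore] -/
theorem kerHom₀_congr {κ κ' : Fin n → ℤ} (h : ∀ i, (κ i : ZMod (dT B S).toNat) = (κ' i : ZMod (dT B S).toNat)) :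
    kerHom₀ (N := N) hB hS hli κ = kerHom₀ hB hS hli κ' := by
  have hdT : ((dT B S).toNat : ℤ) = dT B S := Int.toNat_of_nonneg (dT_pos hB hS hli).le
  choose e he using fun i => (ZMod.intCast_eq_intCast_iff_dvd_sub (κ' i) (κ i) (dT B S).toNat).1 (h i).symm
  have hκ : κ = κ' + dT B S • e := by
    funext i; have := he i; simp only [Pi.add_apply, Pi.smul_apply, smul_eq_mul, hdT] at this ⊢; linarith
  rw [hκ, map_add]
  convert (add_zero _)
  apply Subtype.ext
  change mkG B N S (N • (G B *ᵥ (dT B S • e))) = 0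
  exact mkG_kerVec_dT_smul hB hS hli e

/-- **The surjective homomorphism `(ℤ/dT)ⁿ →+ ker ψ`, `v ↦ [N G v]`.** [folklore] -/
def kerHom : (Fin n → ZMod (dT B S).toNat) →+ (psiM (N := N) hB hS hli).ker where
  toFun v := kerHom₀ hB hS hli fun i => ((v i).val : ℤ)
  map_zero' := by
    rw [show (fun i => (((0 : Fin n → ZMod (dT B S).toNat) i).val : ℤ)) = 0 by funext i; simp]
    exact map_zero _
  map_add' v w := by
    haveI : NeZero (dT B S).toNat := ⟨by have := dT_pos hB hS hli; omega⟩
    rw [← map_add]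
    apply kerHom₀_congr hB hS hli
    intro i
    simp only [Pi.add_apply, Int.cast_add, Int.cast_natCast, ZMod.natCast_zmod_val]

omit [NeZero (MM B N S)] [NeZero (Mo B N)] in
/-- `kerHom (κ mod dT) = [N G κ]`. [folklore] -/
theorem kerHom_intCast (κ : Fin n → ℤ) : kerHom (N := N) hB hS hli (fun i => (κ i : ZMod (dT B S).toNat)) = kerElt hB hS hli κ := by
  haveI : NeZero (dT B S).toNat := ⟨by have := dT_pos hB hS hli; omega⟩
  change kerHom₀ hB hS hli _ = kerHom₀ hB hS hli κ
  apply kerHom₀_congr hB hS hli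
  intro i
  simp only [Int.cast_natCast, ZMod.natCast_zmod_val]

omit [NeZero (Mo B N)] in
/-- **`kerHom` is onto `ker ψ`** (`ker ψ = {[N G κ]}`). [folklore] -/
theorem kerHom_surjective : Function.Surjective (kerHom (N := N) hB hS hli) := by
  rintro ⟨h, hh⟩
  obtain ⟨K, rfl⟩ := mkG_surjective B N S h
  rw [AddMonoidHom.mem_ker] at hh
  obtain ⟨κ, rfl⟩ := exists_eq_kerVec_of_psi_mkG_eq_zero hB _ _ hh
  exact ⟨fun i => (κ i : ZMod (dT B S).toNat), by rw [kerHom_intCast (N := N) hB hS hli]; rfl⟩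

omit [NeZero (Mo B N)] in
/-- **The kernel part from a coin box is within `n·dT/2^ℓ` of uniform on `ker ψ`.** [cite: Goldreich2001, §3.2] -/
theorem tvDist_boxLaw_ker_uniform_le (ℓ : ℕ) :
    ((boxLaw n ℓ).map (kerElt (N := N) hB hS hli)).tvDist (PMF.uniformOfFintype (psiM (N := N) hB hS hli).ker) ≤
      n * (((dT B S).toNat : ℝ) / 2 ^ ℓ) := by
  haveI : NeZero (dT B S).toNat := ⟨by have := dT_pos hB hS hli; omega⟩
  -- `[N G κ] = kerHom (κ mod dT)` and the box reduced mod `dT` coordinatewise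
  have h1 : (boxLaw n ℓ).map (kerElt (N := N) hB hS hli) =
      ((PMF.uniformOfFintype (Fin n → Fin (2 ^ ℓ))).map fun x i => ((x i : ℕ) : ZMod (dT B S).toNat)).map
        (kerHom hB hS hli) := by
    rw [boxLaw, PMF.map_comp, PMF.map_comp]
    congr 1
    funext x
    simp only [Function.comp_apply]
    rw [← kerHom_intCast hB hS hli]
    congr 1; funext i; push_cast; rfl
  rw [h1, ← map_uniformOfFintype_of_surjective (kerHom hB hS hli) (kerHom_surjective hB hS hli)]
  refine (tvDist_map_le_holds _ _ _).trans ?_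
  set f : Fin n → Fin (2 ^ ℓ) → ZMod (dT B S).toNat := fun _ a => ((a : ℕ) : ZMod (dT B S).toNat) with hf
  rw [← indepLaw_uniformOfFintype n,
    show (fun (x : Fin n → Fin (2 ^ ℓ)) (i : Fin n) => ((x i : ℕ) : ZMod (dT B S).toNat)) = fun v j => f j (v j) from rfl,
    indepLaw_map_pi n _ f]
  refine (tvDist_indepLaw_uniformOfFintype_le n _).trans ?_
  calc ∑ _i : Fin n, ((PMF.uniformOfFintype (Fin (2 ^ ℓ))).map fun x : Fin (2 ^ ℓ) => ((x : ℕ) : ZMod (dT B S).toNat)).tvDist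
        (PMF.uniformOfFintype (ZMod (dT B S).toNat))
      ≤ ∑ _i : Fin n, ((dT B S).toNat : ℝ) / 2 ^ ℓ := Finset.sum_le_sum fun i _ => by
          have := tvDist_map_natMod_uniform_le (2 ^ ℓ) (dT B S).toNat
          push_cast at this; exact this
    _ = n * (((dT B S).toNat : ℝ) / 2 ^ ℓ) := by simp

/-! ### The query column and the query matrix -/

/-- **MR07 Lemma 5.8 (i) for the machine, one sample**: for an offset class `c ∼ μ` and
`v`-randomness `κ` uniform on the coin box `[0, 2^ℓ)ⁿ` (independent), the query column
`(aEntOf q (crepInt c) κ ⱼ)ⱼ ∈ (ℤ/q)ⁿ` is within `Δ(μ, U(Grp)) + n·dT/2^ℓ + n·q/N` of uniform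
(`1 ≤ q ≤ N`). [cite: MicciancioRegev2007, Lemma 5.8 (i) with Thm. 5.9 eq. (13)] -/
theorem tvDist_queryColumn_uniform_le {q : ℕ} [NeZero q] (hqN : q ≤ N) (μ : PMF (Grp B N)) (ℓ : ℕ) :
    ((μ.bind fun c => (boxLaw n ℓ).map fun κ => fun j => ((aEntOf B N S q (crepInt B N c) κ j : ℤ) : ZMod q))).tvDist
        (PMF.uniformOfFintype (Fin n → ZMod q)) ≤
      μ.tvDist (PMF.uniformOfFintype (Grp B N)) + n * (((dT B S).toNat : ℝ) / 2 ^ ℓ) + n * ((q : ℝ) / N) := by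
  set P : PMF (GG B N S) := μ.bind fun c => (boxLaw n ℓ).map fun κ => sec B N S c + mkG B N S (N • (G B *ᵥ κ)) with hP
  have hlaw : (μ.bind fun c => (boxLaw n ℓ).map fun κ => fun j => ((aEntOf B N S q (crepInt B N c) κ j : ℤ) : ZMod q)) =
      P.map (queryOf B N S (HS_le_ker_xiMod hB hS hli) q) := by
    rw [hP, PMF.map_bind]
    congr 1; funext c
    rw [PMF.map_comp]
    congr 1; funext κ; funext j
    simp only [Function.comp_apply]
    rw [cast_aEntOf_eq_queryOf hB hS hli]; rfl
  rw [hlaw]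
  refine (tvDist_triangle_holds _ ((PMF.uniformOfFintype (GG B N S)).map (queryOf B N S (HS_le_ker_xiMod hB hS hli) q)) _).trans ?_
  refine add_le_add ((tvDist_map_le_holds _ _ _).trans ?_) (tvDist_map_queryOf_uniform_le hB hS hli hqN)
  exact (tvDist_offsetLaw_uniform_le hB hS hli μ (boxLaw n ℓ)).trans (add_le_add le_rfl (tvDist_boxLaw_ker_uniform_le hB hS hli ℓ))

/-- **MR07 Lemma 5.8 (i) with eq. (13) for the machine, `m` independent samples, matrix form**: with
independent offsets `cᵢ ∼ μᵢ` and independent coin boxes for the `κᵢ`, the query matrix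
`A ∈ ℤ_q^{n×m}` (column `i` = the query of sample `i`, the tree's `SIS` convention) is within
`∑ᵢ (Δ(μᵢ, U(Grp)) + n·dT/2^ℓ + n·q/N)` of uniform. [cite: MicciancioRegev2007, Thm. 5.9 eq. (13) with Lemma 5.8 (i)] -/
theorem tvDist_queryMatrix_uniform_le {q : ℕ} [NeZero q] (hqN : q ≤ N) (m : ℕ) (μ : Fin m → PMF (Grp B N)) (ℓ : ℕ) :
    ((indepLaw m fun i => (μ i).bind fun c => (boxLaw n ℓ).map fun κ => fun j =>
        ((aEntOf B N S q (crepInt B N c) κ j : ℤ) : ZMod q)).map (fun A => Matrix.of fun j i => A i j)).tvDist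
        (PMF.uniformOfFintype (Matrix (Fin n) (Fin m) (ZMod q))) ≤
      ∑ i, ((μ i).tvDist (PMF.uniformOfFintype (Grp B N)) + n * (((dT B S).toNat : ℝ) / 2 ^ ℓ) + n * ((q : ℝ) / N)) := by
  rw [← MicciancioRegev2007.map_transpose_uniformOfFintype (n := n) (q := q) m]
  refine (tvDist_map_le_holds _ _ _).trans ((tvDist_indepLaw_uniformOfFintype_le m _).trans ?_)
  exact Finset.sum_le_sum fun i _ => tvDist_queryColumn_uniform_le hB hS hli hqN (μ i) ℓ

end Main

end DualGrid

end Literature.Algebra.EuclideanLattices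

end
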